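import Summits.QuantumFields.BalabanUV.T4Continuum.Support.NE7MultiplierTermLevelMasses
import Summits.QuantumFields.BalabanUV.T4Continuum.Support.NE3FramePotBoundWClass
import Summits.QuantumFields.BalabanUV.T4Continuum.Support.NE3SmoothLiftW
import HarnessLib

/-!
# NE7LevelMassesOfTower — THE LEVEL MASSES OF THE LINEARISED TOWER ARE BOUNDED BY THE FINE MASS, k-FREE, AND (G3) IN THE UNSCALED CURRENCY:
# `dirSq (dirIter L i W Y) ≤ (8 + 384·d²·L)·dirSq Y` for every `i`, and `|Dm(0)[D²𝒢_{m,W}(0)[ψ,ψ]]| ≤ ε·C(L)·dirSq ψ̃` with `C(L)` INDEPENDENT OF `m`, `j`, `N`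
# (lineage `b2b-balaban-t4-ne7b-p1`, gen 162; ROAD-G116 §6 (G3), the input named by ✓ p834121 `multiplierTerm_le_levelMasses`)

Cell `pub-balaban`, rung (B)+1 sub-cell t4, lineage `b2b-balaban-t4-ne7b-p1` (row NE7b OWNER + CRUX PROVER; junction service for row NE7, ruling R-OWNER-149-1 (2)),
generation 162.  Memo `t4/b2b-balaban-t4-ne7b-p1/g162/records/SCOPING-LEVELMASSES.md`.
INPUTS BY NAME: row NE3's structure theorem ✓ `NE3TangentCovariantTower.dirIter_eq_QbarIter_add_gaugeDir` (`dirIter = QbarIter + gaugeDir (cavgIter) (framePotW)`), the class-only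
ℓ² tower of the straight part ✓ `NE3FramePotBoundWClass.l2sq_QbarIter_le_class` (`≤ 4·(L²∕L^d)^i`), the class-only accumulated-frame bound ✓ `NE3FramePotBoundWClass.sum_norm_framePotW_sq_le_class`
(`≤ 48·d·L`, k-FREE), unitarity of the transports ✓ `AveragingDeficitTransport.norm_Ad_of_unitary`, periodicity ✓ `NE3SmoothLiftW.framePotW_add_period`, and gen 161's (I)
✓ `NE7MultiplierTermLevelMasses.multiplierTerm_le_levelMasses`.
WHAT ([folklore]; 0 def, 0 sorry):
* `dirSq_eq_l2sq` — the two spellings of the torus `ℓ²` functional agree (`rfl`);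
* **`dirSq_dirIter_le`** (`3 ≤ d`, `2 ≤ L`, `1 ≤ N`, base `W` unitary `(L^{j+1}·N)`-periodic with `0 ≤ x`, `LevelSmall d L j x`, `SmallField W x`; `Y` skew, `(L^{j+1}·N)`-periodic):
  `dirSq (dirIter L (j+1) W Y) (periodBox N) ≤ (8·(L²∕L^d)^{j+1} + 384·d²·L)·dirSq Y (periodBox (L^{j+1}·N))`;
* **`dirSq_dirIter_le_uniform`** — every level `i ≤ m+1` of ONE base of the `(m+1)`-tower: `dirSq (dirIter L i W Y) (periodBox (N·L^{m+1−i})) ≤ (8 + 384·d²·L)·dirSq Y (periodBox (N·L^{m+1}))`;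
* **`multiplierTerm_le_fineMass`** (`d = 4`, every `U(n)`, `L ≥ 2`; the frame of (I) verbatim): `|Dm(0)[D²𝒢_{m,W}(0)[ψ,ψ]]| ≤ 2·curl1C·ε·K_C·(2·K_maj·(8 + 384·16·L))·dirSq ψ̃ (periodBox (N·L^{m+1}))` —
  the (G3) chain CLOSED with a constant independent of `m`, `j`, `N`, against the UNSCALED fine mass of the lift.
HONEST FRAMING (page 1): this is NOT (G3) in the scale-correct currency `η²·dirSq` (`η = L^{−(j+1)}`; the gap is `L^{2(j+1)}`), and the memo shows no representative-free bound can close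
that gap (sampled corner-trivial gauge directions: every level mass is `2d·Σ‖λ‖²` while `B = hess = mult = 0` — the per-level terms cancel between adjacent levels); the scaled version
needs a hierarchical gauge representative (memo §3, next files).  Composition of landed kernel theorems about OUR objects; nothing of Bałaban's asserted ([B7] (42), (110)–(125) context
only); NOT (G), NOT NE7 as a spine node, NOT NE3; row NE7b NOT PRINTED ∕ NOT PROVED; spine 0∕9; finite T⁴ rung (B)+1 — NOT infinite volume, NOT mass gap, NOT BetaPertH, NOT Clay.
-/

set_option autoImplicit false

open scoped BigOperators Matrix Matrix.Norms.L2Operator Topology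
open NormedSpace Finset Set Filter Metric

namespace Summit.QuantumFields.BalabanUV.T4Continuum.NE7LevelMassesOfTower

open Literature.MathematicalPhysics.QuantumFieldTheory.Balaban1983to89
open B7Prop1Explicit B7Prop2Explicit MatrixLog UnitaryModel
open T4AveragingDeficitWall (IsUnitaryCfg IsSkewDir SmallField Ad dirSq)
open T4AveragingDeficitWallBoundary (IsPeriodicCfg periodBox sum_periodBox_shift)
open AveragingDeficitPeriodicCounting (IsPeriodicDir)
open AveragingDeficitTransport (norm_Ad_of_unitary)
open AveragingDeficitTorusChart (TDir chart chartDir extDir isPeriodicDir_extDir)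
open AveragingDeficitMultiLevelPrep (tower cavgIter levelQ LevelSmall cavgIter_unitary_small)
open AveragingDeficitMultiLevelBridge (tower_eq)
open AveragingDeficitTwoLevelPrep (skewSub mem_skewSub twoLevelSmall)
open MinimalActionSandwich (IsMinimiser minAct)
open MinimalActionRate (sfClass)
open BlockAveragePushDirGauge (gaugeDir)
open NE3TangentCovariantTower (dirIter QbarIter framePotW dirIter_zero dirIter_eq_QbarIter_add_gaugeDir)
open NE3CovariantLineSumsL2 (l2sq l2sq_nonneg)
open NE3FramePotBoundW (tower_eq_pow_mul levelSmall_of_le)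
open NE3FramePotBoundWClass (l2sq_QbarIter_le_class sum_norm_framePotW_sq_le_class)
open NE3SmoothLiftW (framePotW_add_period)
open NE3HatInvCurlLetters (curl1C curl1C_nonneg)
open BlockAverageVaryHolo (nbRad)
open BlockAverageVaryDisc (rho0)
open NE7MultiplierDensity (chartDir_id_eq_extDir)
open NE7MultiplierTermLevelMasses (multiplierTerm_le_levelMasses)

noncomputable section

variable {d : ℕ} {n : Type} [Fintype n] [DecidableEq n]

/-! ## §1 Bookkeeping -/

/-- `dirSq Y F = l2sq F Y` (the two spellings of the torus `ℓ²` functional in the tree). [folklore] -/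
theorem dirSq_eq_l2sq (Y : Site d → Fin d → Matrix n n ℂ) (F : Finset (Site d)) : dirSq Y F = l2sq F Y := rfl

/-! ## §2 One base, all its levels: the level mass against the fine mass -/

/-- **THE LEVEL MASS OF THE LINEARISED `(j+1)`-FOLD AVERAGE AGAINST THE FINE MASS, k-FREE** (`3 ≤ d`, `2 ≤ L`, `1 ≤ N`; base `W` unitary, `(L^{j+1}·N)`-periodic, in row NE3-R2's
multi-level class `0 ≤ x`, `LevelSmall d L j x`, `SmallField W x`; `Y` skew and `(L^{j+1}·N)`-periodic):
`dirSq (dirIter L (j+1) W Y) (periodBox N) ≤ (8·(L²∕L^d)^{j+1} + 384·d²·L)·dirSq Y (periodBox (L^{j+1}·N))` — straight part `2·4·(L²∕L^d)^{j+1}` (ℓ²-contracting), frame part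
`2·4d·48·d·L` (NOT contracting, NOT growing). [folklore] -/
theorem dirSq_dirIter_le [Nonempty n] (hd : 3 ≤ d) {L : ℕ} (hL : 2 ≤ L) {N : ℕ} (hN : 1 ≤ N) (j : ℕ)
    {W : Site d → Fin d → (Matrix n n ℂ)ˣ} {x : ℝ} (hWu : IsUnitaryCfg W) (hWP : IsPeriodicCfg W ((L ^ (j + 1) * N : ℕ) : ℤ))
    (hx : 0 ≤ x) (hsm : LevelSmall d L j x) (hWx : SmallField W x)
    {Y : Site d → Fin d → Matrix n n ℂ} (hYs : IsSkewDir Y) (hY : IsPeriodicDir Y ((L ^ (j + 1) * N : ℕ) : ℤ)) :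
    dirSq (dirIter L (j + 1) W Y) (periodBox (d := d) N)
      ≤ (8 * ((L : ℝ) ^ 2 / (L : ℝ) ^ d) ^ (j + 1) + 384 * (d : ℝ) ^ 2 * L) * dirSq Y (periodBox (d := d) (L ^ (j + 1) * N)) := by
  classical
  haveI : NeZero N := ⟨by omega⟩
  have hL1 : 1 ≤ L := by omega
  have htow : tower L N (j + 1) = L ^ (j + 1) * N := tower_eq_pow_mul L N (j + 1)
  have hWPt : IsPeriodicCfg W ((tower L N (j + 1) : ℕ) : ℤ) := by rw [htow]; exact hWP
  have hYt : IsPeriodicDir Y ((tower L N (j + 1) : ℕ) : ℤ) := by rw [htow]; exact hY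
  -- the structure theorem
  have hstruct := dirIter_eq_QbarIter_add_gaugeDir (M := N) hL1 j hWu hWPt hx hsm hWx hYs hYt
  set Q : Site d → Fin d → Matrix n n ℂ := QbarIter L (j + 1) W Y with hQ
  set F : Site d → Matrix n n ℂ := framePotW L (j + 1) W Y with hF
  set V : Site d → Fin d → (Matrix n n ℂ)ˣ := cavgIter L (j + 1) W with hV
  have hVu : IsUnitaryCfg V := (cavgIter_unitary_small hL1 j hWu hx hsm hWx).1
  -- the two class letters
  have hQl2 : l2sq (periodBox (d := d) N) Q ≤ 4 * ((L : ℝ) ^ 2 / (L : ℝ) ^ d) ^ (j + 1) * l2sq (periodBox (d := d) (L ^ (j + 1) * N)) Y :=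
    l2sq_QbarIter_le_class (d := d) hL hN (j := j) (j + 1) le_rfl hWu hWP hx hsm hWx hY
  have hFl2 : ∑ z ∈ periodBox (d := d) N, ‖F z‖ ^ 2 ≤ 48 * ((d : ℝ) * L) * l2sq (periodBox (d := d) (L ^ (j + 1) * N)) Y :=
    sum_norm_framePotW_sq_le_class (d := d) hd hL hN j hWu hWP hx hsm hWx hY
  -- periodicity of the accumulated frame
  have hFP : ∀ (z : Site d) (i : Fin d), F (z + (N : ℤ) • e i) = F z := framePotW_add_period L j hWPt hYt
  -- pointwise
  have hpt : ∀ (z : Site d) (κ : Fin d),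
      ‖dirIter L (j + 1) W Y z κ‖ ^ 2 ≤ 2 * ‖Q z κ‖ ^ 2 + 4 * ‖F z‖ ^ 2 + 4 * ‖F (z + e κ)‖ ^ 2 := by
    intro z κ
    have e1 : dirIter L (j + 1) W Y z κ = Q z κ + gaugeDir V F z κ := by rw [hstruct]
    have hG : ‖gaugeDir V F z κ‖ ≤ ‖F z‖ + ‖F (z + e κ)‖ := by
      have hAd : ‖Ad (V z κ)⁻¹ (F z)‖ = ‖F z‖ := norm_Ad_of_unitary ((unitaryUnits (Matrix n n ℂ)).inv_mem (hVu z κ)) (F z)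
      calc ‖gaugeDir V F z κ‖ = ‖Ad (V z κ)⁻¹ (F z) - F (z + e κ)‖ := rfl
        _ ≤ ‖Ad (V z κ)⁻¹ (F z)‖ + ‖F (z + e κ)‖ := norm_sub_le _ _
        _ = ‖F z‖ + ‖F (z + e κ)‖ := by rw [hAd]
    have h1 : ‖dirIter L (j + 1) W Y z κ‖ ≤ ‖Q z κ‖ + ‖gaugeDir V F z κ‖ := by rw [e1]; exact norm_add_le _ _
    have h2 : ‖dirIter L (j + 1) W Y z κ‖ ^ 2 ≤ (‖Q z κ‖ + ‖gaugeDir V F z κ‖) ^ 2 := pow_le_pow_left₀ (norm_nonneg _) h1 2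
    have h3 : ‖gaugeDir V F z κ‖ ^ 2 ≤ (‖F z‖ + ‖F (z + e κ)‖) ^ 2 := pow_le_pow_left₀ (norm_nonneg _) hG 2
    have h4 : (‖Q z κ‖ + ‖gaugeDir V F z κ‖) ^ 2 ≤ 2 * ‖Q z κ‖ ^ 2 + 2 * ‖gaugeDir V F z κ‖ ^ 2 := by
      nlinarith [sq_nonneg (‖Q z κ‖ - ‖gaugeDir V F z κ‖)]
    have h5 : (‖F z‖ + ‖F (z + e κ)‖) ^ 2 ≤ 2 * ‖F z‖ ^ 2 + 2 * ‖F (z + e κ)‖ ^ 2 := by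
      nlinarith [sq_nonneg (‖F z‖ - ‖F (z + e κ)‖)]
    linarith
  -- the shifted frame sums
  have hshift : ∀ κ : Fin d, ∑ z ∈ periodBox (d := d) N, ‖F (z + e κ)‖ ^ 2 = ∑ z ∈ periodBox (d := d) N, ‖F z‖ ^ 2 := by
    intro κ
    refine sum_periodBox_shift N hN (g := fun z => ‖F z‖ ^ 2) (fun x i => ?_) (e κ)
    show ‖F (x + (N : ℤ) • e i)‖ ^ 2 = ‖F x‖ ^ 2
    rw [hFP]
  -- sum the pointwise bound
  have hsum : ∑ z ∈ periodBox (d := d) N, ∑ κ : Fin d, (2 * ‖Q z κ‖ ^ 2 + 4 * ‖F z‖ ^ 2 + 4 * ‖F (z + e κ)‖ ^ 2)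
      = 2 * l2sq (periodBox (d := d) N) Q + 8 * (d : ℝ) * ∑ z ∈ periodBox (d := d) N, ‖F z‖ ^ 2 := by
    have hrow : ∀ z : Site d, ∑ κ : Fin d, (2 * ‖Q z κ‖ ^ 2 + 4 * ‖F z‖ ^ 2 + 4 * ‖F (z + e κ)‖ ^ 2)
        = 2 * ∑ κ : Fin d, ‖Q z κ‖ ^ 2 + 4 * (d : ℝ) * ‖F z‖ ^ 2 + 4 * ∑ κ : Fin d, ‖F (z + e κ)‖ ^ 2 := by
      intro z
      simp only [Finset.sum_add_distrib, ← Finset.mul_sum, Finset.sum_const, Finset.card_univ, Fintype.card_fin, nsmul_eq_mul]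
      ring
    have hQsum : ∑ z ∈ periodBox (d := d) N, (2 * ∑ κ : Fin d, ‖Q z κ‖ ^ 2) = 2 * l2sq (periodBox (d := d) N) Q := by
      rw [← Finset.mul_sum]; rfl
    have hF1 : ∑ z ∈ periodBox (d := d) N, 4 * (d : ℝ) * ‖F z‖ ^ 2 = 4 * (d : ℝ) * ∑ z ∈ periodBox (d := d) N, ‖F z‖ ^ 2 := by
      rw [← Finset.mul_sum]
    have hF2 : ∑ z ∈ periodBox (d := d) N, (4 * ∑ κ : Fin d, ‖F (z + e κ)‖ ^ 2) = 4 * ((d : ℝ) * ∑ z ∈ periodBox (d := d) N, ‖F z‖ ^ 2) := by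
      rw [← Finset.mul_sum, Finset.sum_comm]
      congr 1
      rw [Finset.sum_congr rfl fun κ _ => hshift κ, Finset.sum_const, Finset.card_univ, Fintype.card_fin, nsmul_eq_mul]
    rw [Finset.sum_congr rfl fun z _ => hrow z, Finset.sum_add_distrib, Finset.sum_add_distrib, hQsum, hF1, hF2]
    ring
  have hF0 : 0 ≤ ∑ z ∈ periodBox (d := d) N, ‖F z‖ ^ 2 := Finset.sum_nonneg fun _ _ => sq_nonneg _
  have hd0 : (0 : ℝ) ≤ d := Nat.cast_nonneg d
  calc dirSq (dirIter L (j + 1) W Y) (periodBox (d := d) N)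
      = ∑ z ∈ periodBox (d := d) N, ∑ κ : Fin d, ‖dirIter L (j + 1) W Y z κ‖ ^ 2 := rfl
    _ ≤ ∑ z ∈ periodBox (d := d) N, ∑ κ : Fin d, (2 * ‖Q z κ‖ ^ 2 + 4 * ‖F z‖ ^ 2 + 4 * ‖F (z + e κ)‖ ^ 2) :=
        Finset.sum_le_sum fun z _ => Finset.sum_le_sum fun κ _ => hpt z κ
    _ = 2 * l2sq (periodBox (d := d) N) Q + 8 * (d : ℝ) * ∑ z ∈ periodBox (d := d) N, ‖F z‖ ^ 2 := hsum
    _ ≤ 2 * (4 * ((L : ℝ) ^ 2 / (L : ℝ) ^ d) ^ (j + 1) * l2sq (periodBox (d := d) (L ^ (j + 1) * N)) Y)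
          + 8 * (d : ℝ) * (48 * ((d : ℝ) * L) * l2sq (periodBox (d := d) (L ^ (j + 1) * N)) Y) := by
        have h2 := mul_le_mul_of_nonneg_left hFl2 (by positivity : (0 : ℝ) ≤ 8 * (d : ℝ))
        linarith
    _ = (8 * ((L : ℝ) ^ 2 / (L : ℝ) ^ d) ^ (j + 1) + 384 * (d : ℝ) ^ 2 * L) * dirSq Y (periodBox (d := d) (L ^ (j + 1) * N)) := by
        rw [dirSq_eq_l2sq]; ring

/-- **EVERY LEVEL OF ONE BASE, ONE CONSTANT** (`3 ≤ d`, `2 ≤ L`, `1 ≤ N`): for the base `W` of an `(m+1)`-tower (unitary, `(N·L^{m+1})`-periodic, `0 ≤ x`, `LevelSmall d L m x`, `SmallField W x`)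
and a skew `(N·L^{m+1})`-periodic `Y`, at every level `i ≤ m+1`: `dirSq (dirIter L i W Y) (periodBox (N·L^{m+1−i})) ≤ (8 + 384·d²·L)·dirSq Y (periodBox (N·L^{m+1}))` — the constant does not
depend on `i`, `m`, `N`. [folklore] -/
theorem dirSq_dirIter_le_uniform [Nonempty n] (hd : 3 ≤ d) {L : ℕ} (hL : 2 ≤ L) {N : ℕ} (hN : 1 ≤ N) (m : ℕ)
    {W : Site d → Fin d → (Matrix n n ℂ)ˣ} {x : ℝ} (hWu : IsUnitaryCfg W) (hWP : IsPeriodicCfg W ((N * L ^ (m + 1) : ℕ) : ℤ))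
    (hx : 0 ≤ x) (hsm : LevelSmall d L m x) (hWx : SmallField W x)
    {Y : Site d → Fin d → Matrix n n ℂ} (hYs : IsSkewDir Y) (hY : IsPeriodicDir Y ((N * L ^ (m + 1) : ℕ) : ℤ))
    {i : ℕ} (hi : i ≤ m + 1) :
    dirSq (dirIter L i W Y) (periodBox (d := d) (N * L ^ (m + 1 - i))) ≤ (8 + 384 * (d : ℝ) ^ 2 * L) * dirSq Y (periodBox (d := d) (N * L ^ (m + 1))) := by
  have hD0 : 0 ≤ dirSq Y (periodBox (d := d) (N * L ^ (m + 1))) := by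
    unfold dirSq; exact Finset.sum_nonneg fun _ _ => Finset.sum_nonneg fun _ _ => sq_nonneg _
  cases i with
  | zero =>
      rw [dirIter_zero, Nat.sub_zero]
      have h8 : (1 : ℝ) ≤ 8 + 384 * (d : ℝ) ^ 2 * L := by
        have : (0 : ℝ) ≤ 384 * (d : ℝ) ^ 2 * L := by positivity
        linarith
      exact le_mul_of_one_le_left hD0 h8
  | succ i =>
      -- the base seen as an `(i+1)`-tower over the period `N·L^{m−i}`
      have hN' : 1 ≤ N * L ^ (m - i) := Nat.one_le_iff_ne_zero.mpr (Nat.mul_ne_zero (by omega) (pow_ne_zero _ (by omega)))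
      have hper : L ^ (i + 1) * (N * L ^ (m - i)) = N * L ^ (m + 1) := by
        have him : i + 1 + (m - i) = m + 1 := by omega
        calc L ^ (i + 1) * (N * L ^ (m - i)) = N * (L ^ (i + 1) * L ^ (m - i)) := by ring
          _ = N * L ^ (m + 1) := by rw [← pow_add, him]
      have hWP' : IsPeriodicCfg W ((L ^ (i + 1) * (N * L ^ (m - i)) : ℕ) : ℤ) := by rw [hper]; exact hWP
      have hY' : IsPeriodicDir Y ((L ^ (i + 1) * (N * L ^ (m - i)) : ℕ) : ℤ) := by rw [hper]; exact hY
      have hsm' : LevelSmall d L i x := levelSmall_of_le (by omega) hsm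
      have h := dirSq_dirIter_le hd hL hN' i hWu hWP' hx hsm' hWx hYs hY'
      have hmi : m + 1 - (i + 1) = m - i := by omega
      rw [hper] at h
      rw [hmi]
      refine h.trans (mul_le_mul_of_nonneg_right ?_ hD0)
      have hρ : ((L : ℝ) ^ 2 / (L : ℝ) ^ d) ^ (i + 1) ≤ 1 := by
        refine pow_le_one₀ (by positivity) ?_
        rw [div_le_one (by positivity)]
        exact pow_le_pow_right₀ (by exact_mod_cast (by omega : 1 ≤ L)) (by omega)
      nlinarith

/-! ## §3 (G3) in the unscaled currency: the multiplier term against the fine mass of the lift, constant independent of `m`, `j`, `N` -/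

/-- **THE MULTIPLIER TERM OF THE BORDERED HESSIAN AGAINST THE FINE MASS OF THE LIFT** (`d = 4`, every `U(n)`, `L ≥ 2`; the frame of ✓ `multiplierTerm_le_levelMasses` verbatim):
`∃ ε₀ > 0 ∀ 0 < ε ≤ ε₀ ∀ N ≥ 1 ∃ δ_V > 0 ∀ j ∀ V₀` (unitary, `N`-periodic, `δ_V`-small) `∀ U♯` minimiser, for every `m`, every base `W` (unitary, `(tower L N (m+1))`-periodic, `SmallField W x`,
`0 ≤ x`, `LevelSmall 4 L m x`, `cavgIter L (m+1) W = V₀`) and every `ψ ∈ skewSub (L·tower L N m)`: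
`|Dm(0)[D²𝒢_{m,W}(0)[ψ,ψ]]| ≤ 2·curl1C·ε·K_C·(K_maj·2·(8 + 384·16·L))·dirSq ψ̃ (periodBox (N·L^{m+1}))`, `K_C = (4∕rho0²)·4·(2nbRad+1)⁴`, `K_maj` the road's gen-74 constant — the constant is
INDEPENDENT of `m`, `j`, `N`; the mass is the UNSCALED fine mass of the lift (see the module docstring for what this is not). [folklore] -/
theorem multiplierTerm_le_fineMass [Nonempty n] {L : ℕ} [NeZero L] (hL : 2 ≤ L) :
    ∃ ε₀ : ℝ, 0 < ε₀ ∧ ∀ ε : ℝ, 0 < ε → ε ≤ ε₀ → ∀ (N : ℕ) [NeZero N], 1 ≤ N → ∃ δV : ℝ, 0 < δV ∧ ∀ j : ℕ,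
        ∀ V₀ ∈ {V : Site 4 → Fin 4 → (Matrix n n ℂ)ˣ | IsUnitaryCfg V ∧ IsPeriodicCfg V (N : ℤ) ∧ SmallField V δV},
        ∀ Us : Site 4 → Fin 4 → (Matrix n n ℂ)ˣ, IsMinimiser 4 (sfClass 4 L N ε) L N (j + 1) V₀ Us →
        ∀ (m : ℕ) (W : Site 4 → Fin 4 → (Matrix n n ℂ)ˣ) (x : ℝ), IsUnitaryCfg W → IsPeriodicCfg W ((tower L N (m + 1) : ℕ) : ℤ) → 0 ≤ x →
          LevelSmall 4 L m x → SmallField W x → cavgIter L (m + 1) W = V₀ →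
        ∀ ψ : ↥(skewSub 4 n (L * tower L N m)),
          |fderiv ℝ (fun y : ↥(skewSub 4 n N) => minAct 4 (sfClass 4 L N ε) L N (j + 1) (chart (ContinuousLinearMap.id ℝ (Matrix n n ℂ)) N V₀ (y : TDir 4 n N))) 0
              (fderiv ℝ (fderiv ℝ (fun Φ : TDir 4 n (L * tower L N m) =>
                levelQ L N m W (chart (ContinuousLinearMap.id ℝ (Matrix n n ℂ)) (L * tower L N m) W Φ))) 0
                (ψ : TDir 4 n (L * tower L N m)) (ψ : TDir 4 n (L * tower L N m)))|
            ≤ 2 * curl1C 4 L * ε * (4 / rho0 4 L ^ 2 * ((4 : ℕ) * (2 * nbRad 4 L + 1) ^ 4))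
                * ((Real.exp (((L : ℝ) ^ 4 / L) * (((4 : ℕ) : ℝ) * (16 * (((4 : ℕ) : ℝ) + 1) * (((4 : ℕ) : ℝ) + 4) * (L : ℝ) ^ 2)
                        * (1250 * ((nbRad 4 L : ℝ) + L) + 8 * ((((4 : ℕ) : ℝ)) * L) + 2 * L)) * (2 / twoLevelSmall 4 L))
                      * 2 * (8 + 384 * ((4 : ℕ) : ℝ) ^ 2 * L))
                    * dirSq (chartDir (ContinuousLinearMap.id ℝ (Matrix n n ℂ)) (L * tower L N m) (ψ : TDir 4 n (L * tower L N m)))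
                        (periodBox (d := 4) (N * L ^ (m + 1)))) := by
  obtain ⟨ε₀, hε₀, H⟩ := multiplierTerm_le_levelMasses (n := n) hL
  have hL1 : 1 ≤ L := le_trans (by norm_num) hL
  refine ⟨ε₀, hε₀, fun ε hε hεle N _ hN => ?_⟩
  obtain ⟨δV, hδV, H1⟩ := H ε hε hεle N hN
  refine ⟨δV, hδV, fun j V₀ hV₀ Us hUs m W x hWu hWP hx hs hWx htop ψ => ?_⟩
  have h := H1 j V₀ hV₀ Us hUs m W x hWu hWP hx hs hWx htop ψ
  refine h.trans ?_
  -- abbreviations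
  set C : ℝ := 2 * curl1C 4 L * ε * (4 / rho0 4 L ^ 2 * ((4 : ℕ) * (2 * nbRad 4 L + 1) ^ 4)) with hC
  set K : ℝ := Real.exp (((L : ℝ) ^ 4 / L) * (((4 : ℕ) : ℝ) * (16 * (((4 : ℕ) : ℝ) + 1) * (((4 : ℕ) : ℝ) + 4) * (L : ℝ) ^ 2)
      * (1250 * ((nbRad 4 L : ℝ) + L) + 8 * ((((4 : ℕ) : ℝ)) * L) + 2 * L)) * (2 / twoLevelSmall 4 L)) with hK
  set q : ℝ := (L : ℝ) / (L : ℝ) ^ 4 with hq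
  set ψt : Site 4 → Fin 4 → Matrix n n ℂ := chartDir (ContinuousLinearMap.id ℝ (Matrix n n ℂ)) (L * tower L N m) (ψ : TDir 4 n (L * tower L N m)) with hψt
  set D : ℝ := dirSq ψt (periodBox (d := 4) (N * L ^ (m + 1))) with hD
  set A : ℝ := 8 + 384 * ((4 : ℕ) : ℝ) ^ 2 * L with hA
  have hC0 : 0 ≤ C := by have := curl1C_nonneg 4 L; rw [hC]; positivity
  have hK0 : 0 ≤ K := (Real.exp_pos _).le
  have hD0 : 0 ≤ D := by rw [hD]; unfold dirSq; exact Finset.sum_nonneg fun _ _ => Finset.sum_nonneg fun _ _ => sq_nonneg _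
  have hA0 : 0 ≤ A := by rw [hA]; positivity
  -- the fine direction: skew and periodic
  have hψts : IsSkewDir ψt := fun z κ => (mem_skewSub.mp ψ.2) _ _
  have hper : (L * tower L N m : ℕ) = N * L ^ (m + 1) := by rw [tower_eq]; ring
  have hψtP : IsPeriodicDir ψt ((N * L ^ (m + 1) : ℕ) : ℤ) := by
    rw [← hper, hψt, chartDir_id_eq_extDir]
    haveI : NeZero (L * tower L N m) := ⟨by rw [hper]; exact Nat.mul_ne_zero (NeZero.ne N) (pow_ne_zero _ (NeZero.ne L))⟩
    exact isPeriodicDir_extDir (L * tower L N m) _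
  have hWP' : IsPeriodicCfg W ((N * L ^ (m + 1) : ℕ) : ℤ) := by
    have e : (tower L N (m + 1) : ℕ) = N * L ^ (m + 1) := tower_eq L N (m + 1)
    rw [← e]; exact hWP
  -- every level mass against the fine mass
  have hlev : ∀ i ∈ Finset.range (m + 1), K * q ^ (m - i) * dirSq (dirIter L i W ψt) (periodBox (d := 4) (N * L ^ (m - i + 1)))
      ≤ K * q ^ (m - i) * (A * D) := by
    intro i hi
    have hi' : i ≤ m + 1 := by have := Finset.mem_range.mp hi; omega
    have h1 := dirSq_dirIter_le_uniform (d := 4) (by norm_num) hL hN m hWu hWP' hx hs hWx hψts hψtP hi'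
    have e : m + 1 - i = m - i + 1 := by have := Finset.mem_range.mp hi; omega
    rw [e] at h1
    exact mul_le_mul_of_nonneg_left h1 (mul_nonneg hK0 (pow_nonneg (by rw [hq]; positivity) _))
  -- the geometric sum `Σ_{i<m+1} q^{m-i} ≤ 2`
  have hq0 : 0 ≤ q := by rw [hq]; positivity
  have hq1 : q ≤ 1 / 2 := by
    have hL2 : (2 : ℝ) ≤ L := by exact_mod_cast hL
    have hL0 : (0 : ℝ) < L := by linarith
    rw [hq, div_le_iff₀ (by positivity)]
    have : (L : ℝ) ^ 4 = L * (L * L * L) := by ring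
    rw [this]
    have h8 : (8 : ℝ) ≤ L * L * L := by nlinarith
    nlinarith
  have hgeom : ∑ i ∈ Finset.range (m + 1), q ^ (m - i) ≤ 2 := by
    have hrefl : ∑ i ∈ Finset.range (m + 1), q ^ (m - i) = ∑ i ∈ Finset.range (m + 1), q ^ i := by
      have h := Finset.sum_range_reflect (fun k => q ^ k) (m + 1)
      simpa using h
    rw [hrefl]
    have hg := NE3FramePotBound.geom_sum_le_inv hq0 (by linarith) (m + 1)
    refine hg.trans ?_
    rw [div_le_iff₀ (by linarith)]
    linarith
  calc C * ∑ i ∈ Finset.range (m + 1), K * q ^ (m - i) * dirSq (dirIter L i W ψt) (periodBox (d := 4) (N * L ^ (m - i + 1)))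
      ≤ C * ∑ i ∈ Finset.range (m + 1), K * q ^ (m - i) * (A * D) := mul_le_mul_of_nonneg_left (Finset.sum_le_sum hlev) hC0
    _ = C * (K * (A * D)) * ∑ i ∈ Finset.range (m + 1), q ^ (m - i) := by
        rw [Finset.mul_sum, Finset.mul_sum]
        refine Finset.sum_congr rfl fun i _ => by ring
    _ ≤ C * (K * (A * D)) * 2 := mul_le_mul_of_nonneg_left hgeom (by positivity)
    _ = C * (K * 2 * A * D) := by ring

end

end Summit.QuantumFields.BalabanUV.T4Continuum.NE7LevelMassesOfTower
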